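import Summits.BirchSwinnertonDyer.BirchSwinnertonDyer.Theorems.KolyvaginRoadThreeFrameRigidity
import Summits.BirchSwinnertonDyer.BirchSwinnertonDyer.Theorems.KolyvaginRoadThreeStepLAnyDiscrAtThree
import HarnessLib

/-!
# Route `KolyvaginRoadThree`, deciding crux `ZhangSharpFrameAtThreeHL` (item stmt-BirchSwinnertonDyer-19574): the
# converse «leaf on A1 ⟹ Kolyvagin's conjecture mod 3» holds at EVERY Heegner frame with `L(E^{d_K},1) ≠ 0`,
# `d_K` odd OR EVEN — the parent 19153's surplus over the leaf is exactly the `L(E^{d_K},1) = 0` frames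
# (part 2 of 2; cell `bsd-stepL`, seat `bsd-stepL-zhang3-p1` g3; `--supports stmt-BirchSwinnertonDyer-19574`, helper)

THEOREMS ONLY (no definition, no named fact, no `sorry`); nothing about Kolyvagin's conjecture at `p = 3` and nothing
about `BSD(E,3)` is asserted (`BSDp W 3` ∕ the class are HYPOTHESES); published inputs are named facts of the tree
taken as binders. PARTITION: O2@3 (B10) × A1 (1 116 TRUE-OPEN classes; cw 248 943) — types-the-object-of; closes: none.

THE POINT. `KolyvaginRoadThreeCruxIffLeaf.lean` (p431973) proved `BSDp W 3 ⟹ c₁(n) ≠ 0` at Hoffstein–Luo frames with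
`d_K` ODD, because the tree's STEP-L-from-`BSD(E,p)` bookkeeping at `p = 3` (`BDPRouteOddPrime`∕`BDPRouteRigidity`,
eisenstein-p2's transport `X2.padicValNat_tamagawaProduct_twist_of_heegner_of_odd`) asked `d_K` odd: at an even `d_K`
the twist `E^{(d_K)}` is additive at `2` and `c₂(E^{(d_K)}) = 3` had to be excluded. That exclusion IS a tree
theorem now: Barrios–Roy–Sahajpal–Tallana–Tobin–Wiersema 2025 Thm. 5.1 is vendored AND DISCHARGED
(`c₂ ∈ {1,2,4}` for twists of curves good at `2`), cashed by harvest-2 as the ANY-`d_K` transport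
`O5.TwistTamagawa.padicValNat_tamagawaProduct_twist_of_heegner_three`. With it the whole `p = 3` bookkeeping runs
for every Heegner field (`3 ∤ d_K` and `3 ∤ #𝓞_K^×` from the Heegner hypothesis at `3 ∣ N`; `d_K < −4` from the
frame's orientation), and:

* part 1 (`KolyvaginRoadThreeStepLAnyDiscrAtThree.lean`): `X11b.indexLowerBoundAt_of_bsdp_of_heegnerData_three` ∕
  `X11b.bsdp_of_indexLowerBoundAt_of_heegnerData_three` — STEP L ⟺ `BSD(E,3)` at ANY Heegner datum (the `_of_odd`
  theorems of `BDPRouteRigidity` with `Odd d_K` DELETED); this is part 2: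
* `Koly.kolyvaginClass_one_ne_zero_of_bsdp_of_heegnerFrame_three` — `BSDp W 3` at an A1 curve FORCES a non-zero
  mod-3 Kolyvagin class at EVERY Manin-good conductor-1 frame of EVERY Heegner field with `L(E^{d_K},1) ≠ 0` (any
  parity);
* `Koly.bsdp_three_of_kolyvaginClass_one_ne_zero_at_heegnerFrame` — END TO END at any such frame;
* `Theorems.zhangFrameL_iff_bsdp_onA1` — modulo PUB, «c₁(n) ≠ 0 at every Manin-good frame of every Heegner field with
  `L(E^{d_K},1) ≠ 0` of every A1 curve of class X11b» ⟺ `BSDp` on A1 ⟺ (p431973) `ZhangSharpFrameAtThreeHL`.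
  Hence the parked complement 19575 `ZhangFrameOffHLAtThree` is implied by the leaf on its `d_K`-even ∧
  `L(E^{d_K},1) ≠ 0` ∧ `ClassX11b` part, and the parent 19153 exceeds the leaf EXACTLY on the frames with
  `L(E^{d_K},1) = 0` (`r_an(E/K) ≥ 3`, `y_K` torsion) [or `¬ClassX11b`]. The item's `Odd d_K` binder is harmless (the
  item stays ⟺ the leaf) and could be dropped at a future restatement without changing its strength class.

References (locators only): [cite: BarriosEtAl2025, Thm. 5.1 and §5 tables rows I₀] [cite: WZhang2014, Remark 5, Thm. 10.2]
[cite: McCallumLMS1991, §4 Cor. 4.5, §5 Lemma 5.1 and Cor. 5.6] [cite: GrossLMS1991, §3, §4 (4.1)]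
[cite: JetchevSkinnerWan2017, §7.4.1–7.4.3 and (eq:tamK)] [cite: Skinner2016PacificMC, Thm. C].
-/

noncomputable section

open scoped Classical

/-! ## §2 The converse and the end-to-end theorem at ANY Heegner frame with `L(E^{d_K},1) ≠ 0` -/

namespace Summit.BirchSwinnertonDyer.Rank1Residual.X11b.Three.Koly

open WeierstrassCurve NumberField Literature.NumberTheory.EllipticCurves
  Literature.NumberTheory.EllipticCurves.ModularForms
  Literature.NumberTheory.EllipticCurves.Rank1Residual
  Summit.BirchSwinnertonDyer.Rank1Residual Summit.BirchSwinnertonDyer.Rank1Residual.X11b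

/-- **`BSD(E,3)` at an A1 curve FORCES a non-zero mod-3 Kolyvagin class at every Manin-good conductor-1 frame of
EVERY Heegner field with `L(E^{d_K},1) ≠ 0` — `d_K` odd OR even** (`kolyvaginClass_one_ne_zero_of_bsdp_of_hlFrame`,
p431973, with `Odd d_K` DELETED: `d_K < −4` from the orientation and `3 ∣ N` supplies `d_K ∉ {−3, −4}`; STEP L from
`BSD(E,3)` by §1). PUBLISHED inputs as binders (Gross–Zagier, Kolyvagin, Skinner 2016 Thm. C, GZK, modularity,
Shimura reciprocity at conductor 1, Gross 1991 §3 ×2, McCallum Cor. 5.6 divisibility half); Barrios et al. 2025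
enters as a DISCHARGED tree theorem. CONDITIONAL on every binder; nothing is booked.
[cite: WZhang2014, Remark 5 and Thm. 10.2] [cite: McCallumLMS1991, §5 Lemma 5.1 and Cor. 5.6] [cite: BarriosEtAl2025, Thm. 5.1] -/
theorem kolyvaginClass_one_ne_zero_of_bsdp_of_heegnerFrame_three
    (W : WeierstrassCurve ℚ) [W.IsElliptic] [W.IsGloballyMinimal] [NeZero (W.conductorNorm ℤ)]
    (K : Type) [Field K] [NumberField K]
    (Dt : ModularParametrizationData W (W.conductorNorm ℤ)) (β : ℤ) (ι : K →+* ℂ)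
    (hGZ : gross_zagier (W.conductorNorm ℤ) W K) (hKo : kolyvagin (W.conductorNorm ℤ) W K)
    (hSk : Skinner2016.thmC_padicValRat_bsd_rank_zero)
    (hGZK : rank_eq_analyticRank_of_analyticRank_le_one) (hmod : hasEntireLFunction_rat)
    (hrec : heegnerPointOfConductor_one_galoisConj (W.conductorNorm ℤ) W K)
    (h1 : phi_heegnerPointOfConductor_mem_range_map_ringClassField (W.conductorNorm ℤ) W K)
    (h2 : exists_generator_ringClassGalOver K)
    (hMcU : McCallum1991_padicValNat_card_sha_primary_add_le_of_globalDivisibility)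
    (hX : ClassX11b W 3) (hram : Ram W 3) (htam : ¬ 3 ∣ W.tamagawaProduct)
    (hK : IsImaginaryQuadratic K) (hH : SatisfiesHeegnerHypothesis (W.conductorNorm ℤ) K)
    (hLt : (W.quadraticTwist (NumberField.discr K : ℚ)).entireLFunction 1 ≠ 0)
    (hβ : (4 * (W.conductorNorm ℤ : ℤ)) ∣ β ^ 2 - NumberField.discr K) (hc : ¬ (3 : ℤ) ∣ Dt.c)
    (hbsd : BSDp W 3) :
    ∃ (n : ℕ) (d : KolyvaginHeegnerData Dt β ι n),
      KolyvaginDescent.KolSupp (Zhang2014.IsKolyvaginPrime (W.conductorNorm ℤ) W K 3) n ∧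
        d.kolyvaginClass Nat.prime_three 1 ≠ 0 := by
  haveI : Fact (Nat.Prime 3) := ⟨Nat.prime_three⟩
  have hmult : W.HasMultiplicativeReductionAtPrime 3 := hX.2.2.1
  have hirr : Irr W 3 := hX.2.2.2
  have hρ : Surj W 3 := surj_of_irr_of_ram W 3 hirr hram
  have hsurj : ∀ m : ℕ, W.HasSurjectiveModNGaloisRep (3 ^ m : ℕ) :=
    Rank1Residual.surjective_pow_three_of_mult_of_tateLine W hmult hρ
  have hCM : ¬ W.HasCM := not_hasCM_of_hasMultiplicativeReductionAtPrime' W hmult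
  -- `d_K < −4` from the orientation and `3 ∣ N`; hence `d_K ∉ {−3, −4}`, `d_K < 0`
  have hND : IsCoprime (W.conductorNorm ℤ : ℤ) (NumberField.discr K) := by
    have h := Literature.SatisfiesHeegnerHypothesis.coprime_discr hK.1 hH
    refine Int.isCoprime_iff_gcd_eq_one.mpr ?_
    rw [Int.gcd_eq_natAbs, Int.natAbs_natCast]
    exact h
  have hlt := discr_lt_neg_four_of_isCoprime_of_dvd_sq_sub hK hND (dvd_conductorNorm_of_classX11b hX) hβ
  have h3 : NumberField.discr K ≠ -3 := by omega
  have h4 : NumberField.discr K ≠ -4 := by omega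
  have hDneg : NumberField.discr K < 0 := by omega
  -- the oriented Heegner datum, THE Heegner point, a minimal model of the twist
  obtain ⟨H, hHβ⟩ := exists_heegnerDatum (W.conductorNorm ℤ) hDneg hβ
  obtain ⟨P, hP⟩ := heegnerPointComplex_mem_range_map_holds (W.conductorNorm ℤ) W K hK hH Dt H ι
  have hD0 : (NumberField.discr K : ℚ) ≠ 0 := by exact_mod_cast NumberField.discr_ne_zero K
  haveI hEt : (W.quadraticTwist (NumberField.discr K : ℚ)).IsElliptic := W.isElliptic_quadraticTwist hD0
  obtain ⟨Cd, hCd⟩ := hasGlobalMinimalModel_rat_holds (W.quadraticTwist (NumberField.discr K : ℚ))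
  haveI := hCd
  -- STEP L at `P` from `BSD(E,3)` (§1, any parity)
  have hL : IndexLowerBoundAt W 3 K P :=
    indexLowerBoundAt_of_bsdp_of_heegnerData_three W K Dt H ι P hGZ hKo hSk hGZK hmod hX hram hK hH hP hc hLt
      (Cd • W.quadraticTwist (NumberField.discr K : ℚ)) Cd rfl hbsd
  -- arithmetic of `E(K)`
  have hPinf : ¬ IsOfFinAddOrder P :=
    not_isOfFinAddOrder_of_heegner_of_analyticRank_eq_one W (W.conductorNorm ℤ) K Dt H ι P hGZ hmod hX.1 hK hH
      hLt hP
  obtain ⟨hrank, hSha⟩ := hKo hK hH ⟨Dt, H, ι, hP⟩ hPinf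
  haveI : Finite (W.baseChange K).sha := hSha
  have hbot := torsionBy_eq_bot_of_isImaginaryQuadratic_of_hasIrreducibleModPGaloisRep W K hK Nat.prime_three hirr
  have hiv : ∀ x : (W.baseChange K).toAffine.Point, 3 • x = 0 → x = 0 := fun x hx ↦ by
    have hmem : x ∈ AddSubgroup.torsionBy (W.baseChange K).toAffine.Point ((3 : ℕ) : ℤ) := by
      rw [mem_torsionBy_iff, natCast_zsmul]
      exact hx
    rw [hbot] at hmem
    exact hmem
  haveI : Module.Finite ℤ (W.baseChange K).toAffine.Point := (W.baseChange K).module_finite_point_holds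
  obtain ⟨M₀, x₀, hx₀, hmax⟩ := exists_pow_smul_eq_and_forall_ne hPinf (p := 3) (by norm_num)
  have hdiv : ∃ Q : (W.baseChange K).toAffine.Point, ((3 ^ M₀ : ℕ) : ℤ) • Q = P :=
    ⟨x₀, by rw [natCast_zsmul]; exact hx₀⟩
  have hndiv : ¬ ∃ Q : (W.baseChange K).toAffine.Point, ((3 ^ (M₀ + 1) : ℕ) : ℤ) • Q = P := by
    rintro ⟨Q, hQ⟩
    exact hmax Q (by rw [← natCast_zsmul]; exact hQ)
  -- Kolyvagin–Heegner data at every square-free inert level of the frame (Gross 1991 §3), in particular at 1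
  have hKD : ∀ m : ℕ, Squarefree m → (∀ q ∈ m.primeFactors, (Ideal.span {(q : 𝓞 K)}).IsPrime) →
      Nonempty (KolyvaginHeegnerData Dt β ι m) := fun m hm hinert ↦
    Summit.BirchSwinnertonDyer.BirchSwinnertonDyer.Theorems.nonempty_kolyvaginHeegnerData_of_grossCM h1 h2 hK hH
      Dt β ι hβ hm hinert
  obtain ⟨d₁⟩ := hKD 1 squarefree_one (by simp)
  have hPd : d₁.toGeomPoints d₁.derivedPoint = toGeomPoints (W.baseChange K) P :=
    KolyvaginBottom.toGeomPoints_derivedPoint_one_eq hrec hK hH hP d₁ hHβ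
  -- bridges
  haveI : Finite (AddCommGroup.torsion (W.baseChange K).toAffine.Point) :=
    WeierstrassCurve.finite_torsion_point (W := W.baseChange K)
  obtain ⟨cc, Q, hcQ, hcker⟩ := RankOne.exists_coord_of_mordellWeilRank_eq_one (W.baseChange K) hrank
  have hidx : padicValNat 3 (AddSubgroup.zmultiples P).index = M₀ :=
    padicValNat_index_zmultiples_eq_of_divisibility cc Q hcQ hcker hiv P hdiv hndiv
  have hsha : padicValNat 3 (W.baseChange K).shaOrder =
      padicValNat 3 (Nat.card (AddCommGroup.primaryComponent (W.baseChange K).sha 3)) :=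
    padicValNat_shaOrder_eq (W.baseChange K) 3
  have htam0 : padicValNat 3 W.tamagawaProduct = 0 := padicValNat.eq_zero_of_not_dvd htam
  have hL' : 2 * M₀ ≤ padicValNat 3 (Nat.card (AddCommGroup.primaryComponent (W.baseChange K).sha 3)) := by
    unfold IndexLowerBoundAt at hL
    rw [hidx, hsha, htam0] at hL
    omega
  -- McCallum's divisibility half at depth 1, by contradiction
  by_contra hneg
  have hdivall : ∀ (s : ℕ), s ≤ 1 → ∀ (n : ℕ) (d : KolyvaginHeegnerData Dt β ι n), Squarefree n →
      (∀ ℓ ∈ n.primeFactors, Zhang2014.IsKolyvaginPrime (W.conductorNorm ℤ) W K 3 ℓ ∧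
        s ≤ Zhang2014.kolyvaginIndex W 3 ℓ) →
      ∃ Q : (W.baseChange (ringClassField K ι n)).toAffine.Point, ((3 ^ s : ℕ) : ℤ) • Q = d.derivedPoint := by
    intro s hs n dn hn hℓ
    rcases Nat.eq_zero_or_pos s with rfl | hs1
    · exact ⟨dn.derivedPoint, by simp⟩
    · obtain rfl : s = 1 := le_antisymm hs hs1
      have hsupp : KolyvaginDescent.KolSupp (Zhang2014.IsKolyvaginPrime (W.conductorNorm ℤ) W K 3) n :=
        ⟨hn, fun q hq ↦ (hℓ q hq).1⟩
      have hinert : ∀ m : ℕ, m ∣ n → ∀ q ∈ m.primeFactors, (Ideal.span {(q : 𝓞 K)}).IsPrime :=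
        fun m hm q hq ↦ (hsupp.2 q (Nat.primeFactors_mono hm hn.ne_zero hq)).2.2.2.2.1
      let d : (m : ℕ) → m ∣ n → KolyvaginHeegnerData Dt β ι m := fun m hm ↦
        if h : m = n then h ▸ dn else Classical.choice (hKD m (hn.squarefree_of_dvd hm) (hinert m hm))
      have hdn : d n dvd_rfl = dn := by
        show (if h : n = n then h ▸ dn else _) = dn
        rw [dif_pos rfl]
      by_contra hnd
      have hcert : ¬ PDiv (d n dvd_rfl) 3 1 := by rwa [hdn]
      have hne := KolyCert.kolyvaginClass_three_ne_zero_of_tower_not_pDiv W K Dt β ι hmult hρ hK hH hsupp d hcert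
      rw [hdn] at hne
      exact hneg ⟨n, dn, hsupp, hne⟩
  have hineq := hMcU W hCM K hK h3 h4 hH 3 (by norm_num) hsurj Dt β ι d₁ P hPd hPinf M₀ hdiv hndiv 1 hdivall
  omega

/-- **END TO END at ANY Heegner frame with `L(E^{d_K},1) ≠ 0`** (`bsdp_three_of_kolyvaginClass_one_ne_zero_at_hlFrame`,
p432540, with `Odd d_K` DELETED): ONE non-zero mod-3 Kolyvagin class at ONE Manin-good conductor-1 frame of ANY
Heegner field of an A1 curve ⟹ `BSDp W 3` (STEP L from the certificate by
`Koly.indexLowerBoundAt_of_kolyvaginClass_one_ne_zero_of_mccallum`, then §1's any-parity descent). PUBLISHED inputs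
as binders (incl. Kolyvagin's bound `hB` and McCallum's certificate half `hMc`). CONDITIONAL on every binder;
nothing is booked. [cite: WZhang2014, Remark 5 and Thm. 10.2] [cite: McCallumLMS1991, §5 Cor. 5.6] [cite: BarriosEtAl2025, Thm. 5.1] -/
theorem bsdp_three_of_kolyvaginClass_one_ne_zero_at_heegnerFrame
    (W : WeierstrassCurve ℚ) [W.IsElliptic] [W.IsGloballyMinimal] [NeZero (W.conductorNorm ℤ)]
    (K : Type) [Field K] [NumberField K]
    (Dt : ModularParametrizationData W (W.conductorNorm ℤ)) (β : ℤ) (ι : K →+* ℂ)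
    (hGZ : gross_zagier (W.conductorNorm ℤ) W K) (hKo : kolyvagin (W.conductorNorm ℤ) W K)
    (hB : Kolyvagin1990_padicValNat_card_sha_le (W.conductorNorm ℤ) W K)
    (hSk : Skinner2016.thmC_padicValRat_bsd_rank_zero)
    (hGZK : rank_eq_analyticRank_of_analyticRank_le_one) (hmod : hasEntireLFunction_rat)
    (hrec : heegnerPointOfConductor_one_galoisConj (W.conductorNorm ℤ) W K)
    (h1 : phi_heegnerPointOfConductor_mem_range_map_ringClassField (W.conductorNorm ℤ) W K)
    (h2 : exists_generator_ringClassGalOver K)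
    (hMc : McCallum1991_pow_dvd_card_sha_primary_of_certificate)
    (hX : ClassX11b W 3) (hram : Ram W 3) (htam : ¬ 3 ∣ W.tamagawaProduct)
    (hK : IsImaginaryQuadratic K) (hH : SatisfiesHeegnerHypothesis (W.conductorNorm ℤ) K)
    (hLt : (W.quadraticTwist (NumberField.discr K : ℚ)).entireLFunction 1 ≠ 0)
    (hβ : (4 * (W.conductorNorm ℤ : ℤ)) ∣ β ^ 2 - NumberField.discr K) (hc : ¬ (3 : ℤ) ∣ Dt.c)
    {n : ℕ} (d : KolyvaginHeegnerData Dt β ι n)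
    (hn : KolyvaginDescent.KolSupp (Zhang2014.IsKolyvaginPrime (W.conductorNorm ℤ) W K 3) n)
    (hne : d.kolyvaginClass Nat.prime_three 1 ≠ 0) :
    BSDp W 3 := by
  haveI : Fact (Nat.Prime 3) := ⟨Nat.prime_three⟩
  have hmult : W.HasMultiplicativeReductionAtPrime 3 := hX.2.2.1
  have hirr : Irr W 3 := hX.2.2.2
  have hρ : Surj W 3 := surj_of_irr_of_ram W 3 hirr hram
  have hsurj : ∀ m : ℕ, W.HasSurjectiveModNGaloisRep (3 ^ m : ℕ) :=
    Rank1Residual.surjective_pow_three_of_mult_of_tateLine W hmult hρ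
  have hCM : ¬ W.HasCM := not_hasCM_of_hasMultiplicativeReductionAtPrime' W hmult
  have hND : IsCoprime (W.conductorNorm ℤ : ℤ) (NumberField.discr K) := by
    have h := Literature.SatisfiesHeegnerHypothesis.coprime_discr hK.1 hH
    refine Int.isCoprime_iff_gcd_eq_one.mpr ?_
    rw [Int.gcd_eq_natAbs, Int.natAbs_natCast]
    exact h
  have hlt := discr_lt_neg_four_of_isCoprime_of_dvd_sq_sub hK hND (dvd_conductorNorm_of_classX11b hX) hβ
  have h3 : NumberField.discr K ≠ -3 := by omega
  have h4 : NumberField.discr K ≠ -4 := by omega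
  have hDneg : NumberField.discr K < 0 := by omega
  obtain ⟨H, hHβ⟩ := exists_heegnerDatum (W.conductorNorm ℤ) hDneg hβ
  obtain ⟨P, hP⟩ := heegnerPointComplex_mem_range_map_holds (W.conductorNorm ℤ) W K hK hH Dt H ι
  have hD0 : (NumberField.discr K : ℚ) ≠ 0 := by exact_mod_cast NumberField.discr_ne_zero K
  haveI hEt : (W.quadraticTwist (NumberField.discr K : ℚ)).IsElliptic := W.isElliptic_quadraticTwist hD0
  obtain ⟨Cd, hCd⟩ := hasGlobalMinimalModel_rat_holds (W.quadraticTwist (NumberField.discr K : ℚ))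
  haveI := hCd
  have hPinf : ¬ IsOfFinAddOrder P :=
    not_isOfFinAddOrder_of_heegner_of_analyticRank_eq_one W (W.conductorNorm ℤ) K Dt H ι P hGZ hmod hX.1 hK hH
      hLt hP
  obtain ⟨hrank, hSha⟩ := hKo hK hH ⟨Dt, H, ι, hP⟩ hPinf
  haveI : Finite (W.baseChange K).sha := hSha
  have hbot := torsionBy_eq_bot_of_isImaginaryQuadratic_of_hasIrreducibleModPGaloisRep W K hK Nat.prime_three hirr
  have hiv : ∀ x : (W.baseChange K).toAffine.Point, 3 • x = 0 → x = 0 := fun x hx ↦ by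
    have hmem : x ∈ AddSubgroup.torsionBy (W.baseChange K).toAffine.Point ((3 : ℕ) : ℤ) := by
      rw [mem_torsionBy_iff, natCast_zsmul]
      exact hx
    rw [hbot] at hmem
    exact hmem
  haveI : Module.Finite ℤ (W.baseChange K).toAffine.Point := (W.baseChange K).module_finite_point_holds
  obtain ⟨M₀, x₀, hx₀, hmax⟩ := exists_pow_smul_eq_and_forall_ne hPinf (p := 3) (by norm_num)
  have hdiv : ∃ Q : (W.baseChange K).toAffine.Point, ((3 ^ M₀ : ℕ) : ℤ) • Q = P :=
    ⟨x₀, by rw [natCast_zsmul]; exact hx₀⟩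
  have hndiv : ¬ ∃ Q : (W.baseChange K).toAffine.Point, ((3 ^ (M₀ + 1) : ℕ) : ℤ) • Q = P := by
    rintro ⟨Q, hQ⟩
    exact hmax Q (by rw [← natCast_zsmul]; exact hQ)
  obtain ⟨d₁⟩ := Summit.BirchSwinnertonDyer.BirchSwinnertonDyer.Theorems.nonempty_kolyvaginHeegnerData_of_grossCM
    h1 h2 hK hH Dt β ι hβ squarefree_one (by simp)
  have hPd : d₁.toGeomPoints d₁.derivedPoint = toGeomPoints (W.baseChange K) P :=
    KolyvaginBottom.toGeomPoints_derivedPoint_one_eq hrec hK hH hP d₁ hHβ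
  -- STEP L from the certificate (McCallum), then `BSD(E,3)` by §1's any-parity descent
  have hL : IndexLowerBoundAt W 3 K P :=
    indexLowerBoundAt_of_kolyvaginClass_one_ne_zero_of_mccallum W K hMc hCM hK h3 h4 hH 3 (by norm_num) hsurj Dt β ι
      d₁ P hPd hPinf hrank hiv hdiv hndiv d hn hne
  exact bsdp_of_indexLowerBoundAt_of_heegnerData_three W K Dt H ι P hGZ hKo hB hSk hGZK hmod hX hram htam hK hH hP
    hc hLt (Cd • W.quadraticTwist (NumberField.discr K : ℚ)) Cd rfl hL

end Summit.BirchSwinnertonDyer.Rank1Residual.X11b.Three.Koly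

/-! ## §3 The statement for the record: the parent's surplus over the leaf is exactly the `L(E^{d_K},1) = 0` frames -/

namespace Summit.BirchSwinnertonDyer.BirchSwinnertonDyer.Theorems

open WeierstrassCurve NumberField Literature.NumberTheory.EllipticCurves
  Literature.NumberTheory.EllipticCurves.ModularForms
  Literature.NumberTheory.EllipticCurves.Rank1Residual
  Summit.BirchSwinnertonDyer.Rank1Residual Summit.BirchSwinnertonDyer.Rank1Residual.X11b
  Summit.BirchSwinnertonDyer.BirchSwinnertonDyer.Theses.KolyvaginRoadThree

/-- **Modulo the published inputs: «a non-zero mod-3 Kolyvagin class at every Manin-good conductor-1 frame of EVERY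
imaginary quadratic Heegner field with `L(E^{d_K},1) ≠ 0` (any parity of `d_K`) of every A1 curve of class X11b» ⟺
`BSDp` on A1** (⟸ `Koly.kolyvaginClass_one_ne_zero_of_bsdp_of_heegnerFrame_three`; ⟹ through the HL item, which the
any-parity statement contains, and `bsdp_onA1_of_zhangSharpFrameAtThreeHL`, p431973). With
`zhangSharpFrameAtThreeHL_iff_bsdp_onA1` this says: the HL item, this `Odd`-free strengthening of it, and the leaf on
A1 are ALL EQUIVALENT; the parent 19153 differs from them only on frames with `L(E^{d_K},1) = 0` (where `y_K` is
torsion, `r_an(E/K) ≥ 3`) — the parked complement 19575 `ZhangFrameOffHLAtThree` is needed only there.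
CONDITIONAL on every binder; nothing is booked; BSD is proved for no curve here.
[cite: WZhang2014, Thm. 1.1, Remark 5 and Thm. 10.2] [cite: McCallumLMS1991, §5 Lemma 5.1 and Cor. 5.6] [cite: BarriosEtAl2025, Thm. 5.1] -/
theorem zhangFrameL_iff_bsdp_onA1
    (hGZ : ∀ (N : ℕ) [NeZero N] (W : WeierstrassCurve ℚ) (K : Type) [Field K] [NumberField K],
      gross_zagier N W K)
    (hKo : ∀ (N : ℕ) [NeZero N] (W : WeierstrassCurve ℚ) (K : Type) [Field K] [NumberField K],
      kolyvagin N W K)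
    (hB : ∀ (N : ℕ) [NeZero N] (W : WeierstrassCurve ℚ) (K : Type) [Field K] [NumberField K],
      Kolyvagin1990_padicValNat_card_sha_le N W K)
    (hSk : Skinner2016.thmC_padicValRat_bsd_rank_zero)
    (hGZK : rank_eq_analyticRank_of_analyticRank_le_one) (hmod : hasEntireLFunction_rat)
    (hnf : exists_isNewformOf) (hHL : HoffsteinLuo1997_exists_twist_L_one_ne_zero)
    (hMaz : mazur_not_dvd_maninConstant_of_odd)
    (hrec : ∀ (N : ℕ) [NeZero N] (W : WeierstrassCurve ℚ) (K : Type) [Field K] [NumberField K],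
      heegnerPointOfConductor_one_galoisConj N W K)
    (hMc : McCallum1991_pow_dvd_card_sha_primary_of_certificate)
    (hMcU : McCallum1991_padicValNat_card_sha_primary_add_le_of_globalDivisibility)
    (h1 : ∀ (N : ℕ) [NeZero N] (W : WeierstrassCurve ℚ) (K : Type) [Field K] [NumberField K],
      phi_heegnerPointOfConductor_mem_range_map_ringClassField N W K)
    (h2 : ∀ (K : Type) [Field K] [NumberField K], exists_generator_ringClassGalOver K) :
    (∀ (W : WeierstrassCurve ℚ) [W.IsElliptic] [W.IsGloballyMinimal] [NeZero (W.conductorNorm ℤ)]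
        (K : Type) [Field K] [NumberField K]
        (Dt : ModularParametrizationData W (W.conductorNorm ℤ)) (β : ℤ) (ι : K →+* ℂ),
        ClassX11b W 3 → Ram W 3 → ¬ 3 ∣ W.tamagawaProduct → IsImaginaryQuadratic K →
        SatisfiesHeegnerHypothesis (W.conductorNorm ℤ) K →
        (W.quadraticTwist (NumberField.discr K : ℚ)).entireLFunction 1 ≠ 0 →
        (4 * (W.conductorNorm ℤ : ℤ)) ∣ β ^ 2 - NumberField.discr K → ¬ (3 : ℤ) ∣ Dt.c →
        ∃ (n : ℕ) (d : KolyvaginHeegnerData Dt β ι n),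
          KolyvaginDescent.KolSupp (Zhang2014.IsKolyvaginPrime (W.conductorNorm ℤ) W K 3) n ∧
            d.kolyvaginClass Nat.prime_three 1 ≠ 0) ↔
      ∀ (W : WeierstrassCurve ℚ) [W.IsElliptic] [W.IsGloballyMinimal],
        ClassX11b W 3 → Ram W 3 → ¬ 3 ∣ W.tamagawaProduct → BSDp W 3 := by
  constructor
  · -- the any-parity statement contains the HL item; then the HL kernel
    intro h
    refine bsdp_onA1_of_zhangSharpFrameAtThreeHL hGZ hKo hB hSk hGZK hmod hnf hHL hMaz hrec hMc h1 h2 ?_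
    intro W _ _ _ K _ _ Dt β ι hX _hmult _hsurj hram htam hK _hodd hH hLt _h3 hβ hc
    exact h W K Dt β ι hX hram htam hK hH hLt hβ hc
  · intro hbsd W _ _ _ K _ _ Dt β ι hX hram htam hK hH hLt hβ hc
    exact Summit.BirchSwinnertonDyer.Rank1Residual.X11b.Three.Koly.kolyvaginClass_one_ne_zero_of_bsdp_of_heegnerFrame_three
      W K Dt β ι (hGZ _ W K) (hKo _ W K) hSk hGZK hmod (hrec _ W K) (h1 _ W K) (h2 K) hMcU hX hram htam hK hH hLt hβ
      hc (hbsd W hX hram htam)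

end Summit.BirchSwinnertonDyer.BirchSwinnertonDyer.Theorems

end
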